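import Mathlib.Analysis.InnerProductSpace.PiL2
import Mathlib.Analysis.InnerProductSpace.Calculus
import Mathlib.Analysis.Calculus.Deriv.MeanValue
import Mathlib.Analysis.Calculus.Deriv.Inv
import Mathlib.Analysis.Calculus.Deriv.Mul
import Mathlib.Analysis.Calculus.Deriv.Comp
import Mathlib.Analysis.SpecialFunctions.Sqrt
import Mathlib.Algebra.QuadraticDiscriminant

/-!
# A generic C^{1,1} chord lemma for radial functions on `ℝ³` (lens-5 g53, crux 27623 T-side, leaf (C) of node T2-bent₁ — PROVED)

`ChordC11`: let `W : ℝ → ℝ` be `C¹` on `[a, b]` (`a > 0`) with derivative `W₁`, and, off a finite set `J ⊆ ℝ`, let `W₁` be differentiable on `(a, b)`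
with `|W₁′| ≤ K` and `|W₁(r)| ≤ K·r`.  If the whole segment `p + sΔ` (`0 ≤ s ≤ 1`) has norm in `[a, b]`, then
`W‖p‖ + D(W∘‖·‖)(p)·Δ − ½K‖Δ‖² ≤ W‖p + Δ‖` (`chordC11_holds`).
PROOF (elementary, sorry-free): along the segment `ρ(s) = ‖p + sΔ‖ = √(‖p‖² + 2⟨p,Δ⟩s + ‖Δ‖²s²)` is smooth with `ρ′ = σ := ⟨p + sΔ, Δ⟩/ρ`, `σ² ≤ ‖Δ‖²`
(Cauchy–Schwarz); `g = W∘ρ` has `g′ = G := W₁(ρ)σ`, and wherever `ρ(s) ∈ (a, b) ∖ J`,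
`G′ = W₁′(ρ)σ² + W₁(ρ)(‖Δ‖² − σ²)/ρ ≥ −Kσ² − K(‖Δ‖² − σ²) = −K‖Δ‖²` (`chordGd_nonneg`).  The exceptional parameters (`ρ(s) ∈ J ∪ {a, b}`) are among
the roots of finitely many nontrivial quadratics (`mem_segExc`, quadratic formula), so `h = G + K‖Δ‖²·id` — continuous on `[0, 1]` — is monotone on each
exceptional-free piece (`monotoneOn_of_hasDerivWithinAt_nonneg`) and hence on `[0, 1]` by induction on the number of exceptional points strictly inside
(`chordH_le`); therefore `Φ = g − G(0)·id + ½K‖Δ‖²·id²` is monotone, i.e. `g(1) ≥ g(0) + G(0) − ½K‖Δ‖²`, and `G(0) = D(W∘‖·‖)(p)·Δ` by the chain rule and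
uniqueness of derivatives.  Purely generic (no tree imports); instantiated for the record potential `W₄₅` in `…TaylorLeaves`.
-/

open scoped BigOperators Classical

namespace Summit.AtomisticToContinuum.Crystallization.Theorems.FrustratedLawDichotomyStrainedPatchTaylorChord

/-! ## §1. The statement -/

/-- **(C) `ChordC11`** [REAL ANALYSIS · generic C^{1,1} chord lemma · TRUE-type] — `W` is `C¹` on `[a, b] ∋ ‖p + sΔ‖` (`0 ≤ s ≤ 1`, `a > 0`) and, off a
finite set `J`, twice differentiable with `|W″| ≤ K`, `|W′(r)| ≤ K·r` on `(a, b)`; then `W‖p‖ + D(W∘‖·‖)(p)·Δ − ½K‖Δ‖² ≤ W‖p+Δ‖`.  (Route: `g(s) = W(ρ(s))`,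
`ρ = ‖p + sΔ‖`; `g″ = W″(ρ)ρ′² + W′(ρ)(‖Δ‖² − ρ′²)/ρ ≥ −K‖Δ‖²` off the finitely many `s` with `ρ(s) ∈ J ∪ {a, b}`; `g′ + K‖Δ‖²·id` is continuous and
monotone piece by piece, hence monotone; integrate once.) -/
def ChordC11 : Prop :=
  ∀ (W W₁ : ℝ → ℝ) (J : Finset ℝ) (K a b : ℝ) (p Δ : EuclideanSpace ℝ (Fin 3)), 0 < a → 0 ≤ K →
    (∀ r, a ≤ r → r ≤ b → HasDerivAt W (W₁ r) r) → ContinuousOn W₁ (Set.Icc a b) →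
    (∀ r, a < r → r < b → r ∉ J → HasDerivAt W₁ (deriv W₁ r) r ∧ |deriv W₁ r| ≤ K ∧ |W₁ r| ≤ K * r) →
    (∀ s ∈ Set.Icc (0 : ℝ) 1, a ≤ ‖p + s • Δ‖ ∧ ‖p + s • Δ‖ ≤ b) →
    W ‖p‖ + fderiv ℝ (fun x : EuclideanSpace ℝ (Fin 3) => W ‖x‖) p Δ - K / 2 * ‖Δ‖ ^ 2 ≤ W ‖p + Δ‖



/-! ## §2. The segment parametrisation `ρ(s) = ‖p + sΔ‖` -/

/-- `‖p + sΔ‖² = ‖p‖² + 2⟨p,Δ⟩ s + ‖Δ‖² s²`. -/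
theorem norm_sq_segment (p Δ : (EuclideanSpace ℝ (Fin 3))) (s : ℝ) : ‖p + s • Δ‖ ^ 2 = ‖p‖ ^ 2 + 2 * inner ℝ p Δ * s + ‖Δ‖ ^ 2 * (s * s) := by
  have h1 := norm_add_sq_real p (s • Δ)
  rw [real_inner_smul_right, norm_smul, mul_pow, Real.norm_eq_abs, sq_abs] at h1
  linear_combination h1

/-- The radius `ρ(s) = ‖p + sΔ‖`. -/
noncomputable def segR (p Δ : (EuclideanSpace ℝ (Fin 3))) (s : ℝ) : ℝ := ‖p + s • Δ‖
/-- Half the derivative of `ρ²`: `N(s) = ⟨p,Δ⟩ + ‖Δ‖² s = ⟨p + sΔ, Δ⟩`. -/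
noncomputable def segN (p Δ : (EuclideanSpace ℝ (Fin 3))) (s : ℝ) : ℝ := inner ℝ p Δ + ‖Δ‖ ^ 2 * s
/-- `ρ′ = N/ρ`. -/
noncomputable def segS (p Δ : (EuclideanSpace ℝ (Fin 3))) (s : ℝ) : ℝ := segN p Δ s / segR p Δ s

/-- `N(s) = ⟨p + s•Δ, Δ⟩`. -/
theorem segN_eq_inner (p Δ : (EuclideanSpace ℝ (Fin 3))) (s : ℝ) : segN p Δ s = inner ℝ (p + s • Δ) Δ := by
  rw [segN, inner_add_left, real_inner_smul_left, real_inner_self_eq_norm_sq]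
  ring

/-- `ρ(s) = ‖p + s•Δ‖` is continuous in the parameter `s`. -/
theorem segR_continuous (p Δ : (EuclideanSpace ℝ (Fin 3))) : Continuous (segR p Δ) := by
  unfold segR; fun_prop

/-- `N′(s) = ‖Δ‖²`. -/
theorem hasDerivAt_segN (p Δ : (EuclideanSpace ℝ (Fin 3))) (s : ℝ) : HasDerivAt (segN p Δ) (‖Δ‖ ^ 2) s := by
  have hfun : segN p Δ = fun y => inner ℝ p Δ + ‖Δ‖ ^ 2 * y := rfl
  rw [hfun]
  exact (((hasDerivAt_id' s).const_mul (‖Δ‖ ^ 2)).const_add (inner ℝ p Δ)).congr_deriv (mul_one _)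

/-- `ρ′(s) = N(s)/ρ(s)` wherever `ρ(s) ≠ 0`. -/
theorem hasDerivAt_segR {p Δ : (EuclideanSpace ℝ (Fin 3))} {s : ℝ} (h0 : segR p Δ s ≠ 0) : HasDerivAt (segR p Δ) (segS p Δ s) s := by
  have hq : HasDerivAt (fun y : ℝ => ‖p‖ ^ 2 + 2 * inner ℝ p Δ * y + ‖Δ‖ ^ 2 * (y * y))
      (2 * inner ℝ p Δ * 1 + ‖Δ‖ ^ 2 * (1 * s + s * 1)) s :=
    (((hasDerivAt_id' s).const_mul _).const_add _).add (((hasDerivAt_id' s).mul (hasDerivAt_id' s)).const_mul _)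
  have hfun : segR p Δ = fun y => Real.sqrt (‖p‖ ^ 2 + 2 * inner ℝ p Δ * y + ‖Δ‖ ^ 2 * (y * y)) := by
    funext y; rw [← norm_sq_segment, Real.sqrt_sq (norm_nonneg _)]; rfl
  have hqs : ‖p‖ ^ 2 + 2 * inner ℝ p Δ * s + ‖Δ‖ ^ 2 * (s * s) ≠ 0 := by
    rw [← norm_sq_segment]; exact pow_ne_zero 2 h0
  have h := hq.sqrt hqs
  rw [hfun]
  have hsq : Real.sqrt (‖p‖ ^ 2 + 2 * inner ℝ p Δ * s + ‖Δ‖ ^ 2 * (s * s)) = segR p Δ s := by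
    rw [← norm_sq_segment, Real.sqrt_sq (norm_nonneg _)]; rfl
  refine h.congr_deriv ?_
  rw [hsq, segS, segN]
  field_simp
  ring

/-- `|ρ′| ≤ ‖Δ‖`, as `σ² ≤ ‖Δ‖²`. -/
theorem segS_sq_le {p Δ : (EuclideanSpace ℝ (Fin 3))} {s : ℝ} (h0 : 0 < segR p Δ s) : segS p Δ s ^ 2 ≤ ‖Δ‖ ^ 2 := by
  have hcs : |segN p Δ s| ≤ segR p Δ s * ‖Δ‖ := by rw [segN_eq_inner]; exact abs_real_inner_le_norm _ _
  have habs : |segS p Δ s| ≤ ‖Δ‖ := by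
    rw [segS, abs_div, abs_of_pos h0, div_le_iff₀ h0]; linarith [mul_comm (segR p Δ s) ‖Δ‖]
  have := abs_le.1 habs
  nlinarith [this.1, this.2, norm_nonneg Δ]

/-- `σ′ = (‖Δ‖²ρ − Nσ)/ρ²`. -/
theorem hasDerivAt_segS {p Δ : (EuclideanSpace ℝ (Fin 3))} {s : ℝ} (h0 : segR p Δ s ≠ 0) :
    HasDerivAt (segS p Δ) ((‖Δ‖ ^ 2 * segR p Δ s - segN p Δ s * segS p Δ s) / segR p Δ s ^ 2) s :=
  (hasDerivAt_segN p Δ s).div (hasDerivAt_segR h0) h0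

/-! ## §3. The one-variable functions along the chord -/

section chord
variable {W W₁ : ℝ → ℝ} {J : Finset ℝ} {K a b : ℝ} {p Δ : (EuclideanSpace ℝ (Fin 3))}

/-- `G = (W∘ρ)′ = W₁(ρ)·σ`. -/
noncomputable def segG (W₁ : ℝ → ℝ) (p Δ : (EuclideanSpace ℝ (Fin 3))) (s : ℝ) : ℝ := W₁ (segR p Δ s) * segS p Δ s
/-- `G′` at good points. -/
noncomputable def segGd (W₁ : ℝ → ℝ) (p Δ : (EuclideanSpace ℝ (Fin 3))) (s : ℝ) : ℝ :=
  deriv W₁ (segR p Δ s) * segS p Δ s * segS p Δ s + W₁ (segR p Δ s) * ((‖Δ‖ ^ 2 * segR p Δ s - segN p Δ s * segS p Δ s) / segR p Δ s ^ 2)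
/-- `h = G + K‖Δ‖²·id`. -/
noncomputable def segH (W₁ : ℝ → ℝ) (K : ℝ) (p Δ : (EuclideanSpace ℝ (Fin 3))) (s : ℝ) : ℝ := segG W₁ p Δ s + K * ‖Δ‖ ^ 2 * s

/-- Chain rule: `(W ∘ ρ)′(s) = W₁(ρ(s))·ρ′(s) = G(s)` while `ρ(s) ∈ [a,b]`. -/
theorem hasDerivAt_chordG (hW : ∀ r, a ≤ r → r ≤ b → HasDerivAt W (W₁ r) r) (ha : 0 < a) {s : ℝ} (h1 : a ≤ segR p Δ s) (h2 : segR p Δ s ≤ b) :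
    HasDerivAt (fun y => W (segR p Δ y)) (segG W₁ p Δ s) s :=
  (hW _ h1 h2).comp s (hasDerivAt_segR (ha.trans_le h1).ne')

/-- Derivative of `h = G + K‖Δ‖²·id` at a non-exceptional parameter, and its nonnegativity. -/
theorem hasDerivAt_chordH (hgood : ∀ r, a < r → r < b → r ∉ J → HasDerivAt W₁ (deriv W₁ r) r ∧ |deriv W₁ r| ≤ K ∧ |W₁ r| ≤ K * r) (ha : 0 < a)
    {s : ℝ} (h1 : a < segR p Δ s) (h2 : segR p Δ s < b) (hJ : segR p Δ s ∉ J) :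
    HasDerivAt (segH W₁ K p Δ) (segGd W₁ p Δ s + K * ‖Δ‖ ^ 2) s := by
  have h0 : segR p Δ s ≠ 0 := (ha.trans h1).ne'
  have hA : HasDerivAt (fun y => W₁ (segR p Δ y)) (deriv W₁ (segR p Δ s) * segS p Δ s) s := (hgood _ h1 h2 hJ).1.comp s (hasDerivAt_segR h0)
  have hG : HasDerivAt (segG W₁ p Δ) (segGd W₁ p Δ s) s := hA.mul (hasDerivAt_segS h0)
  have hl := ((hasDerivAt_id' s).const_mul (K * ‖Δ‖ ^ 2))
  show HasDerivAt (fun y => segG W₁ p Δ y + K * ‖Δ‖ ^ 2 * y) _ s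
  exact (hG.add hl).congr_deriv (by rw [mul_one])

/-- The second-order sign: `G′ + K‖Δ‖² ≥ 0` at good points (`|W″| ≤ K`, `|W′| ≤ Kρ`, `σ² ≤ ‖Δ‖²`, `ρ > 0`). -/
theorem chordGd_nonneg (hgood : ∀ r, a < r → r < b → r ∉ J → HasDerivAt W₁ (deriv W₁ r) r ∧ |deriv W₁ r| ≤ K ∧ |W₁ r| ≤ K * r) (ha : 0 < a)
    {s : ℝ} (h1 : a < segR p Δ s) (h2 : segR p Δ s < b) (hJ : segR p Δ s ∉ J) : 0 ≤ segGd W₁ p Δ s + K * ‖Δ‖ ^ 2 := by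
  have h0 : 0 < segR p Δ s := ha.trans h1
  obtain ⟨-, hdW, hW1⟩ := hgood _ h1 h2 hJ
  have hσ2 := segS_sq_le h0
  have hN : segN p Δ s = segS p Δ s * segR p Δ s := by rw [segS, div_mul_cancel₀ _ h0.ne']
  have key : (‖Δ‖ ^ 2 * segR p Δ s - segN p Δ s * segS p Δ s) / segR p Δ s ^ 2 = (‖Δ‖ ^ 2 - segS p Δ s ^ 2) / segR p Δ s := by
    rw [hN]
    field_simp
  have ht : 0 ≤ (‖Δ‖ ^ 2 - segS p Δ s ^ 2) / segR p Δ s := div_nonneg (sub_nonneg.2 hσ2) h0.le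
  have e1 : -(K * segS p Δ s ^ 2) ≤ deriv W₁ (segR p Δ s) * segS p Δ s ^ 2 := by nlinarith [(abs_le.1 hdW).1, sq_nonneg (segS p Δ s)]
  have e2 : -(K * segR p Δ s) * ((‖Δ‖ ^ 2 - segS p Δ s ^ 2) / segR p Δ s) ≤ W₁ (segR p Δ s) * ((‖Δ‖ ^ 2 - segS p Δ s ^ 2) / segR p Δ s) :=
    mul_le_mul_of_nonneg_right (abs_le.1 hW1).1 ht
  have e3 : K * segR p Δ s * ((‖Δ‖ ^ 2 - segS p Δ s ^ 2) / segR p Δ s) = K * (‖Δ‖ ^ 2 - segS p Δ s ^ 2) := by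
    field_simp
  unfold segGd
  rw [key]
  nlinarith [e1, e2, e3]

/-- Continuity of `h` on `[0,1]`. -/
theorem continuousOn_chordH (hcont : ContinuousOn W₁ (Set.Icc a b)) (ha : 0 < a) (htube : ∀ s ∈ Set.Icc (0 : ℝ) 1, a ≤ ‖p + s • Δ‖ ∧ ‖p + s • Δ‖ ≤ b) :
    ContinuousOn (segH W₁ K p Δ) (Set.Icc 0 1) := by
  have hρ : ContinuousOn (segR p Δ) (Set.Icc 0 1) := (segR_continuous p Δ).continuousOn
  have hWρ : ContinuousOn (fun s => W₁ (segR p Δ s)) (Set.Icc 0 1) := hcont.comp hρ fun s hs => ⟨(htube s hs).1, (htube s hs).2⟩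
  have hN : ContinuousOn (segN p Δ) (Set.Icc 0 1) := by unfold segN; fun_prop
  have hσ : ContinuousOn (segS p Δ) (Set.Icc 0 1) := hN.div hρ fun s hs => (ha.trans_le (htube s hs).1).ne'
  unfold segH segG
  exact (hWρ.mul hσ).add (by fun_prop)

/-! ## §4. The exceptional parameters: a finite superset (quadratic formula) -/

/-- The two roots of `‖Δ‖² s² + 2⟨p,Δ⟩ s + (‖p‖² − v²) = 0` (junk if none). -/
noncomputable def segRoots (p Δ : (EuclideanSpace ℝ (Fin 3))) (v : ℝ) : Finset ℝ :=
  {(-(2 * inner ℝ p Δ) + Real.sqrt (discrim (‖Δ‖ ^ 2) (2 * inner ℝ p Δ) (‖p‖ ^ 2 - v ^ 2))) / (2 * ‖Δ‖ ^ 2),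
   (-(2 * inner ℝ p Δ) - Real.sqrt (discrim (‖Δ‖ ^ 2) (2 * inner ℝ p Δ) (‖p‖ ^ 2 - v ^ 2))) / (2 * ‖Δ‖ ^ 2)}

/-- All parameters at which `ρ` takes a value in `V`. -/
noncomputable def segExc (p Δ : (EuclideanSpace ℝ (Fin 3))) (V : Finset ℝ) : Finset ℝ := V.biUnion (segRoots p Δ)

/-- A parameter at which `ρ` takes a value in `V` is one of the finitely many exceptional parameters `segExc p Δ V`. -/
theorem mem_segExc {p Δ : (EuclideanSpace ℝ (Fin 3))} (hΔ : Δ ≠ 0) {V : Finset ℝ} {s : ℝ} (hs : segR p Δ s ∈ V) : s ∈ segExc p Δ V := by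
  unfold segExc
  refine Finset.mem_biUnion.2 ⟨segR p Δ s, hs, ?_⟩
  have hd : ‖Δ‖ ^ 2 ≠ 0 := pow_ne_zero 2 (norm_ne_zero_iff.2 hΔ)
  have hquad : ‖Δ‖ ^ 2 * (s * s) + 2 * inner ℝ p Δ * s + (‖p‖ ^ 2 - segR p Δ s ^ 2) = 0 := by
    rw [segR, norm_sq_segment]; ring
  have hD := discrim_eq_sq_of_quadratic_eq_zero hquad
  set D := discrim (‖Δ‖ ^ 2) (2 * inner ℝ p Δ) (‖p‖ ^ 2 - segR p Δ s ^ 2) with hDdef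
  have hD0 : 0 ≤ D := by rw [hD]; exact sq_nonneg _
  have hDs : D = Real.sqrt D * Real.sqrt D := (Real.mul_self_sqrt hD0).symm
  have hroots := (quadratic_eq_zero_iff hd hDs s).1 hquad
  unfold segRoots
  rw [Finset.mem_insert, Finset.mem_singleton]
  exact hroots

/-! ## §5. Monotonicity of `h = g′ + K‖Δ‖²·id` on `[0,1]` (piecewise, induction on exceptional points) -/

/-- `h` is monotone on a closed sub-interval of `[0,1]` whose interior avoids the exceptional parameters. -/
theorem chordH_le_piece (hcont : ContinuousOn W₁ (Set.Icc a b)) (ha : 0 < a)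
    (hgood : ∀ r, a < r → r < b → r ∉ J → HasDerivAt W₁ (deriv W₁ r) r ∧ |deriv W₁ r| ≤ K ∧ |W₁ r| ≤ K * r)
    (htube : ∀ s ∈ Set.Icc (0 : ℝ) 1, a ≤ ‖p + s • Δ‖ ∧ ‖p + s • Δ‖ ≤ b) (hΔ : Δ ≠ 0)
    {x y : ℝ} (hx : 0 ≤ x) (hy : y ≤ 1) (hxy : x ≤ y)
    (hfree : ∀ t ∈ segExc p Δ (insert a (insert b J)), ¬ (x < t ∧ t < y)) :
    segH W₁ K p Δ x ≤ segH W₁ K p Δ y := by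
  have hsub : Set.Icc x y ⊆ Set.Icc 0 1 := Set.Icc_subset_Icc hx hy
  have hmono : MonotoneOn (segH W₁ K p Δ) (Set.Icc x y) := by
    refine monotoneOn_of_hasDerivWithinAt_nonneg (convex_Icc x y) ((continuousOn_chordH hcont ha htube).mono hsub)
      (f' := fun s => segGd W₁ p Δ s + K * ‖Δ‖ ^ 2) ?_ ?_
    · intro s hs
      rw [interior_Icc] at hs
      have hs01 : s ∈ Set.Icc (0:ℝ) 1 := ⟨hx.trans hs.1.le, hs.2.le.trans hy⟩
      have hgoodS := good_of_free ha htube hΔ hfree hs hs01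
      exact (hasDerivAt_chordH hgood ha hgoodS.1 hgoodS.2.1 hgoodS.2.2).hasDerivWithinAt
    · intro s hs
      rw [interior_Icc] at hs
      have hs01 : s ∈ Set.Icc (0:ℝ) 1 := ⟨hx.trans hs.1.le, hs.2.le.trans hy⟩
      have hgoodS := good_of_free ha htube hΔ hfree hs hs01
      exact chordGd_nonneg hgood ha hgoodS.1 hgoodS.2.1 hgoodS.2.2
  exact hmono (Set.left_mem_Icc.2 hxy) (Set.right_mem_Icc.2 hxy) hxy
where
  good_of_free (ha : 0 < a) (htube : ∀ s ∈ Set.Icc (0 : ℝ) 1, a ≤ ‖p + s • Δ‖ ∧ ‖p + s • Δ‖ ≤ b) (hΔ : Δ ≠ 0)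
      {x y : ℝ} (hfree : ∀ t ∈ segExc p Δ (insert a (insert b J)), ¬ (x < t ∧ t < y)) {s : ℝ} (hs : s ∈ Set.Ioo x y)
      (hs01 : s ∈ Set.Icc (0:ℝ) 1) : a < segR p Δ s ∧ segR p Δ s < b ∧ segR p Δ s ∉ J := by
    have hnot : segR p Δ s ∉ insert a (insert b J) := fun hmem => hfree s (mem_segExc hΔ hmem) hs
    simp only [Finset.mem_insert, not_or] at hnot
    obtain ⟨hna, hnb, hnJ⟩ := hnot
    have ht := htube s hs01
    exact ⟨lt_of_le_of_ne ht.1 (Ne.symm hna), lt_of_le_of_ne ht.2 hnb, hnJ⟩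

/-- `h` is monotone on `[0,1]`: `h 0 ≤ h 1` (induction over the finitely many exceptional parameters). -/
theorem chordH_le (hcont : ContinuousOn W₁ (Set.Icc a b)) (ha : 0 < a)
    (hgood : ∀ r, a < r → r < b → r ∉ J → HasDerivAt W₁ (deriv W₁ r) r ∧ |deriv W₁ r| ≤ K ∧ |W₁ r| ≤ K * r)
    (htube : ∀ s ∈ Set.Icc (0 : ℝ) 1, a ≤ ‖p + s • Δ‖ ∧ ‖p + s • Δ‖ ≤ b) (hΔ : Δ ≠ 0) :
    ∀ n : ℕ, ∀ x y : ℝ, 0 ≤ x → y ≤ 1 → x ≤ y →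
      ((segExc p Δ (insert a (insert b J))).filter (fun t => x < t ∧ t < y)).card ≤ n → segH W₁ K p Δ x ≤ segH W₁ K p Δ y := by
  intro n
  induction n with
  | zero =>
    intro x y hx hy hxy hcard
    have hemp := Finset.card_eq_zero.1 (Nat.le_zero.1 hcard)
    refine chordH_le_piece hcont ha hgood htube hΔ hx hy hxy fun t ht hxt => ?_
    have : t ∈ (segExc p Δ (insert a (insert b J))).filter (fun t => x < t ∧ t < y) := Finset.mem_filter.2 ⟨ht, hxt⟩
    rw [hemp] at this
    exact absurd this (Finset.notMem_empty t)
  | succ n ih =>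
    intro x y hx hy hxy hcard
    by_cases hex : ∃ t ∈ segExc p Δ (insert a (insert b J)), x < t ∧ t < y
    · obtain ⟨t, ht, hxt, hty⟩ := hex
      set T := (segExc p Δ (insert a (insert b J))).filter (fun t => x < t ∧ t < y) with hT
      have htT : t ∈ T := Finset.mem_filter.2 ⟨ht, hxt, hty⟩
      have hc1 : ((segExc p Δ (insert a (insert b J))).filter (fun u => x < u ∧ u < t)).card ≤ n := by
        have hsub : (segExc p Δ (insert a (insert b J))).filter (fun u => x < u ∧ u < t) ⊆ T.erase t := by
          intro u hu
          obtain ⟨hu1, hu2, hu3⟩ := Finset.mem_filter.1 hu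
          exact Finset.mem_erase.2 ⟨hu3.ne, Finset.mem_filter.2 ⟨hu1, hu2, hu3.trans hty⟩⟩
        have := Finset.card_le_card hsub
        rw [Finset.card_erase_of_mem htT] at this
        omega
      have hc2 : ((segExc p Δ (insert a (insert b J))).filter (fun u => t < u ∧ u < y)).card ≤ n := by
        have hsub : (segExc p Δ (insert a (insert b J))).filter (fun u => t < u ∧ u < y) ⊆ T.erase t := by
          intro u hu
          obtain ⟨hu1, hu2, hu3⟩ := Finset.mem_filter.1 hu
          exact Finset.mem_erase.2 ⟨hu2.ne', Finset.mem_filter.2 ⟨hu1, hxt.trans hu2, hu3⟩⟩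
        have := Finset.card_le_card hsub
        rw [Finset.card_erase_of_mem htT] at this
        omega
      exact (ih x t hx (hty.le.trans hy) hxt.le hc1).trans (ih t y (hx.trans hxt.le) hy hty.le hc2)
    · exact chordH_le_piece hcont ha hgood htube hΔ hx hy hxy fun t ht hxt => hex ⟨t, ht, hxt⟩

end chord

/-! ## §6. The theorem -/

/-- ★★★ **(C) PROVED**: the generic C^{1,1} chord lemma `ChordC11`. [folklore] -/
theorem chordC11_holds : ChordC11 := by
  intro W W₁ J K a b p Δ ha hK hW hcont hgood htube
  by_cases hΔ : Δ = 0
  · subst hΔ; simp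
  have hp01 : ∀ s ∈ Set.Icc (0:ℝ) 1, a ≤ segR p Δ s ∧ segR p Δ s ≤ b := htube
  -- derivative of g = W∘ρ on [0,1]
  have hg : ∀ s ∈ Set.Icc (0:ℝ) 1, HasDerivAt (fun y => W (segR p Δ y)) (segG W₁ p Δ s) s :=
    fun s hs => hasDerivAt_chordG hW ha (hp01 s hs).1 (hp01 s hs).2
  -- h(0) ≤ h(s) on [0,1]
  have hmon : ∀ s ∈ Set.Icc (0:ℝ) 1, segH W₁ K p Δ 0 ≤ segH W₁ K p Δ s := fun s hs =>
    chordH_le hcont ha hgood htube hΔ _ 0 s le_rfl hs.2 hs.1 le_rfl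
  -- Φ(s) = g(s) − G(0)s + K‖Δ‖²/2 s² is monotone on [0,1]
  set Φ : ℝ → ℝ := fun s => W (segR p Δ s) - segG W₁ p Δ 0 * s + K * ‖Δ‖ ^ 2 / 2 * s ^ 2 with hΦ
  have hΦd : ∀ s ∈ Set.Icc (0:ℝ) 1, HasDerivAt Φ (segG W₁ p Δ s - segG W₁ p Δ 0 + K * ‖Δ‖ ^ 2 * s) s := by
    intro s hs
    have h1 := (hg s hs).sub ((hasDerivAt_id' s).const_mul (segG W₁ p Δ 0))
    have h2 := ((hasDerivAt_pow 2 s).const_mul (K * ‖Δ‖ ^ 2 / 2))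
    have h := h1.add h2
    refine h.congr_deriv ?_
    simp; ring
  have hΦmono : MonotoneOn Φ (Set.Icc 0 1) := by
    refine monotoneOn_of_hasDerivWithinAt_nonneg (convex_Icc 0 1) ?_ (fun s hs => (hΦd s (interior_subset hs)).hasDerivWithinAt) ?_
    · exact fun s hs => (hΦd s hs).continuousAt.continuousWithinAt
    · intro s hs
      rw [interior_Icc] at hs
      have := hmon s ⟨hs.1.le, hs.2.le⟩
      simp only [segH] at this
      linarith
  have h01 := hΦmono (Set.left_mem_Icc.2 zero_le_one) (Set.right_mem_Icc.2 zero_le_one) zero_le_one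
  simp only [hΦ] at h01
  -- values at the ends
  have hρ0 : segR p Δ 0 = ‖p‖ := by simp [segR]
  have hρ1 : segR p Δ 1 = ‖p + Δ‖ := by simp [segR]
  -- G(0) is the directional derivative
  have hp0 : p ≠ 0 := by
    intro h; have := (hp01 0 (Set.left_mem_Icc.2 zero_le_one)).1; rw [hρ0, h, norm_zero] at this; linarith
  have hpa : a ≤ ‖p‖ ∧ ‖p‖ ≤ b := by simpa [hρ0] using hp01 0 (Set.left_mem_Icc.2 zero_le_one)
  have hnorm : HasFDerivAt (fun x : (EuclideanSpace ℝ (Fin 3)) => ‖x‖) (fderiv ℝ (fun x : (EuclideanSpace ℝ (Fin 3)) => ‖x‖) p) p :=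
    ((differentiableAt_id).norm ℝ hp0).hasFDerivAt
  have hF : HasFDerivAt (fun x : (EuclideanSpace ℝ (Fin 3)) => W ‖x‖) (W₁ ‖p‖ • fderiv ℝ (fun x : (EuclideanSpace ℝ (Fin 3)) => ‖x‖) p) p :=
    (hW ‖p‖ hpa.1 hpa.2).comp_hasFDerivAt p hnorm
  have hpt : p + (0:ℝ) • Δ = p := by simp
  have hF0 : HasFDerivAt (fun x : (EuclideanSpace ℝ (Fin 3)) => W ‖x‖) (W₁ ‖p‖ • fderiv ℝ (fun x : (EuclideanSpace ℝ (Fin 3)) => ‖x‖) p) (p + (0:ℝ) • Δ) := by rw [hpt]; exact hF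
  have hline : HasDerivAt (fun s : ℝ => p + s • Δ) Δ 0 := by
    simpa using ((hasDerivAt_id' (0:ℝ)).smul_const Δ).const_add p
  have hcomp := hF0.comp_hasDerivAt (0:ℝ) hline
  have hg0 : HasDerivAt (fun y => W (segR p Δ y)) (segG W₁ p Δ 0) 0 := hg 0 (Set.left_mem_Icc.2 zero_le_one)
  have hG0 : segG W₁ p Δ 0 = (W₁ ‖p‖ • fderiv ℝ (fun x : (EuclideanSpace ℝ (Fin 3)) => ‖x‖) p) Δ := hg0.unique hcomp
  rw [hF.fderiv, ← hG0]
  rw [hρ0, hρ1] at h01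
  linarith

end Summit.AtomisticToContinuum.Crystallization.Theorems.FrustratedLawDichotomyStrainedPatchTaylorChord
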